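import Mathlib
import Summits.ValiantsHypothesis.ValiantsHypothesis.Theorems.BarrierLeverPartitionMinorsHitByVPHiddenStatesBallCutThirdShellReduction

/-!
# Route BarrierLever — item `PartitionMinorsHitByVP` (stmt-ValiantsHypothesis-19717), line `hidden-states`:
# ★★ THE m-TH SHELL REDUCES TO ITS TOTALLY UNBALANCED CORES — every `m`

Helper file (`--supports stmt-ValiantsHypothesis-19717`; cell valiant-natproofs, 𝒟-side door (c), registered line
`Cruxes/PartitionMinorsHitByVP/Lines/hidden_states.lean` v9; prover seat val-np-p6 gen 21).  Closes NO item; definition-free.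

THE THEOREM (memo HOME/val-np-p6/g21/MEMO-valnp6-g21.md §4; the `m = 3` instance with the landed first/second shells plugged in is
`BallCut.exists_table_threeSwap_of_unbalanced`).  An m-swap family `(A, C)` on `Fin n` (`|A_l| = t`, `|C_l| = t + 1`, injective,
`A_l ⊄ C_{l'}`) is TOTALLY UNBALANCED when every coordinate lies in unequally many `A_l` and `C_l`.
★★ `exists_table_multiSwap_of_unbalanced`: if for every `m ≤ M` every totally unbalanced m-swap family is served (on its support, standard
form), then for every `m ≤ M` EVERY m-swap family is served, at every `h, t`.  So the whole conjecture column «the m-th shell of every ball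
is served» (S_m, all m) is equivalent to its restriction to totally unbalanced cores, shell by shell.  PROOF = induction on the coordinate
set: at a coordinate with `#A = #C = k` the exact cut (`BallCut.served_of_erase_free` for `k = 0`, `BallCut.served_of_erase_balanced` for
`k ≥ 1`) splits the family into a `k`-swap LINK and an `(m-k)`-swap DELETION on fewer coordinates (the `0`-swap family is the ball,
`BallCut.symGood_ball`); with no balanced coordinate the family is a core and the hypothesis, pulled back along the increasing enumeration
of the coordinate set (`BallCut.map_preimage_orderEmb`) and pushed forward (`BallCut.served_image_of_served`), serves it.

HONEST LABEL: a reduction inside the conjecture column; 19717 stays OPEN; nothing on crux 14610 or VP ≠ VNP.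
-/

set_option linter.dupNamespace false

namespace Summit.ValiantsHypothesis.ValiantsHypothesis.Theorems.BarrierLever.HiddenStates

open Finset

noncomputable section

namespace BallCut

open SymbJoin

variable {h : ℕ}

/-- **Every m-swap family (`m ≤ M`) inside `S` is served on `S`, given that the totally unbalanced ones are** (induction on `|S|`). -/
theorem served_multiSwap_on_of_unbalanced (M : ℕ)
    (H : ∀ m, m ≤ M → ∀ (n t : ℕ) (A C : Fin m → Finset (Fin n)), (∀ l, (A l).card = t) → (∀ l, (C l).card = t + 1) →
      Function.Injective A → Function.Injective C → (∀ l l', ¬ A l ⊆ C l') →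
      (∀ x : Fin n, (Finset.univ.filter fun l => x ∈ A l).card ≠ (Finset.univ.filter fun l => x ∈ C l).card) →
      ∀ ⦃r : ℕ⦄ (u cols : Fin r → Finset (Fin n)), Function.Injective u →
        (∀ i, ((u i).card ≤ t ∧ ∀ l, u i ≠ A l) ∨ ∃ l, u i = C l) →
        (∀ J : Finset (Fin n), J.card ≤ t → ∃ kk, cols kk = J) →
        ∃ tx : Option (Fin n) → Fin n → ℂ,
          (Matrix.of fun i kk : Fin r => ∏ a ∈ u i, (tx none a + ∑ q ∈ cols kk, tx (some q) a)).det ≠ 0)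
    (n : ℕ) : ∀ (S : Finset (Fin h)), S.card = n → ∀ (m : ℕ), m ≤ M → ∀ (t : ℕ) (A C : Fin m → Finset (Fin h)),
      (∀ l, (A l).card = t) → (∀ l, (C l).card = t + 1) → Function.Injective A → Function.Injective C →
      (∀ l l', ¬ A l ⊆ C l') → (∀ l, A l ⊆ S) → (∀ l, C l ⊆ S) →
      ∀ ⦃r : ℕ⦄ (u cols : Fin r → Finset (Fin h)), Function.Injective u → Function.Injective cols →
        (∀ U, (∃ i, u i = U) ↔ ((U ⊆ S ∧ U.card ≤ t ∧ ∀ l, U ≠ A l) ∨ ∃ l, U = C l)) →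
        (∀ J, (∃ kk, cols kk = J) ↔ (J ⊆ S ∧ J.card ≤ t)) →
        symDet u (fun kk => ((0 : Fin 1), cols kk)) ≠ 0 := by
  classical
  induction n with
  | zero =>
    intro S hS m hm t A C hA hC hAi hCi hAC hAS hCS r u cols hu hcinj hU hJ
    have hS0 : S = ∅ := Finset.card_eq_zero.1 hS
    rcases Nat.eq_zero_or_pos m with rfl | hmpos
    · -- no swaps: the ball
      exact symGood_ball u cols hu fun U => by
        rw [hU U, hJ U]; simp only [IsEmpty.forall_iff, IsEmpty.exists_iff, and_true, or_false]
    · have l0 : Fin m := ⟨0, hmpos⟩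
      have hA0 : A l0 = ∅ := Finset.subset_empty.1 (by rw [← hS0]; exact hAS l0)
      have hC0 : C l0 = ∅ := Finset.subset_empty.1 (by rw [← hS0]; exact hCS l0)
      have := hC l0; rw [hC0, Finset.card_empty] at this; omega
  | succ n ih =>
    intro S hS m hm t A C hA hC hAi hCi hAC hAS hCS r u cols hu hcinj hU hJ
    rcases Nat.eq_zero_or_pos m with rfl | hmpos
    · exact symGood_ball u cols hu fun U => by
        rw [hU U, hJ U]; simp only [IsEmpty.forall_iff, IsEmpty.exists_iff, and_true, or_false]
    by_cases hbal : ∃ x ∈ S, (Finset.univ.filter fun l => x ∈ A l).card = (Finset.univ.filter fun l => x ∈ C l).card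
    · obtain ⟨x, hxS, hx⟩ := hbal
      have hS' : (S.erase x).card = n := by rw [Finset.card_erase_of_mem hxS, hS]; rfl
      obtain ⟨k, hk⟩ : ∃ k, (Finset.univ.filter fun l => x ∈ A l).card = k := ⟨_, rfl⟩
      have hkC : (Finset.univ.filter fun l => x ∈ C l).card = k := by rw [← hx]; exact hk
      obtain ⟨k', hk'⟩ : ∃ k', (Finset.univ.filter fun l => x ∉ A l).card = k' := ⟨_, rfl⟩
      have hkk' : k + k' = m := by
        have := Finset.card_filter_add_card_filter_not (s := (Finset.univ : Finset (Fin m))) (fun l => x ∈ A l)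
        rw [hk, hk'] at this; simpa using this
      have hk'C : (Finset.univ.filter fun l => x ∉ C l).card = k' := by
        have := Finset.card_filter_add_card_filter_not (s := (Finset.univ : Finset (Fin m))) (fun l => x ∈ C l)
        rw [hkC] at this; simp only [Finset.card_univ, Fintype.card_fin] at this; omega
      rcases Nat.eq_zero_or_pos k with hk0 | hkpos
      · -- `k = 0`: `x` is free
        have hxA : ∀ l, x ∉ A l := fun l hl =>
          (Finset.filter_eq_empty_iff.1 (Finset.card_eq_zero.1 (hk.trans hk0))) (Finset.mem_univ l) hl
        have hxC : ∀ l, x ∉ C l := fun l hl =>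
          (Finset.filter_eq_empty_iff.1 (Finset.card_eq_zero.1 (hkC.trans hk0))) (Finset.mem_univ l) hl
        have hAS' : ∀ l, A l ⊆ S.erase x := fun l a ha => Finset.mem_erase.2 ⟨fun hax => hxA l (hax ▸ ha), hAS l ha⟩
        have hCS' : ∀ l, C l ⊆ S.erase x := fun l a ha => Finset.mem_erase.2 ⟨fun hax => hxC l (hax ▸ ha), hCS l ha⟩
        exact served_of_erase_free t A C hA hC hAi hCi S x hAS' hCS'
          (ih (S.erase x) hS' m hm t A C hA hC hAi hCi hAC hAS' hCS') u cols hu hcinj hU hJ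
      · -- `k ≥ 1`: balanced cut; `t = t' + 1`
        have hne : (Finset.univ.filter fun l => x ∈ A l).Nonempty := by rw [← Finset.card_pos, hk]; exact hkpos
        obtain ⟨l₀, hl₀⟩ := hne
        have hxl₀ : x ∈ A l₀ := (Finset.mem_filter.1 hl₀).2
        obtain ⟨t', rfl⟩ : ∃ t', t = t' + 1 :=
          ⟨t - 1, by have := Finset.card_pos.2 ⟨x, hxl₀⟩; rw [hA l₀] at this; omega⟩
        refine served_of_erase_balanced t' A C hA hC hAi hCi S x hxS hAS hx ?_ ?_ u cols hu hcinj hU hJ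
        · -- THE LINK: the `k` swaps through `x`, `x` erased, level `t'`; served by the induction hypothesis (`k ≤ m ≤ M`)
          intro r' u' cols' hu' hc' hU' hJ'
          let eA : Fin k ↪o Fin m := (Finset.univ.filter fun l => x ∈ A l).orderEmbOfFin hk
          let eC : Fin k ↪o Fin m := (Finset.univ.filter fun l => x ∈ C l).orderEmbOfFin hkC
          have heA : ∀ j, x ∈ A (eA j) := fun j =>
            (Finset.mem_filter.1 (Finset.orderEmbOfFin_mem (Finset.univ.filter fun l => x ∈ A l) hk j)).2
          have heC : ∀ j, x ∈ C (eC j) := fun j =>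
            (Finset.mem_filter.1 (Finset.orderEmbOfFin_mem (Finset.univ.filter fun l => x ∈ C l) hkC j)).2
          have heAsur : ∀ l, x ∈ A l → ∃ j, eA j = l := fun l hl => by
            have : l ∈ Set.range eA := by
              rw [show Set.range eA = ↑(Finset.univ.filter fun l => x ∈ A l) from Finset.range_orderEmbOfFin _ hk]
              simp [hl]
            exact this
          have heCsur : ∀ l, x ∈ C l → ∃ j, eC j = l := fun l hl => by
            have : l ∈ Set.range eC := by
              rw [show Set.range eC = ↑(Finset.univ.filter fun l => x ∈ C l) from Finset.range_orderEmbOfFin _ hkC]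
              simp [hl]
            exact this
          let A₁ : Fin k → Finset (Fin h) := fun j => (A (eA j)).erase x
          let C₁ : Fin k → Finset (Fin h) := fun j => (C (eC j)).erase x
          have hA₁ : ∀ j, (A₁ j).card = t' := fun j => by
            have := Finset.card_erase_of_mem (heA j); simp only [A₁]; rw [this, hA]; rfl
          have hC₁ : ∀ j, (C₁ j).card = t' + 1 := fun j => by
            have := Finset.card_erase_of_mem (heC j); simp only [C₁]; rw [this, hC]; rfl
          have hA₁i : Function.Injective A₁ := fun j j' hjj' => eA.injective (hAi (by
            rw [← Finset.insert_erase (heA j), ← Finset.insert_erase (heA j')]; exact congrArg _ hjj'))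
          have hC₁i : Function.Injective C₁ := fun j j' hjj' => eC.injective (hCi (by
            rw [← Finset.insert_erase (heC j), ← Finset.insert_erase (heC j')]; exact congrArg _ hjj'))
          have hA₁C₁ : ∀ j j', ¬ A₁ j ⊆ C₁ j' := fun j j' hsub => hAC (eA j) (eC j') (by
            rw [← Finset.insert_erase (heA j), ← Finset.insert_erase (heC j')]
            exact Finset.insert_subset_insert x hsub)
          refine ih (S.erase x) hS' k (by omega) t' A₁ C₁ hA₁ hC₁ hA₁i hC₁i hA₁C₁
            (fun j => Finset.erase_subset_erase x (hAS _)) (fun j => Finset.erase_subset_erase x (hCS _))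
            u' cols' hu' hc' (fun U => ?_) hJ'
          rw [hU' U]
          have e1 : (∀ l, x ∈ A l → U ≠ (A l).erase x) ↔ ∀ j, U ≠ A₁ j :=
            ⟨fun H' j => H' (eA j) (heA j), fun H' l hl => by obtain ⟨j, rfl⟩ := heAsur l hl; exact H' j⟩
          have e2 : (∃ l, x ∈ C l ∧ U = (C l).erase x) ↔ ∃ j, U = C₁ j :=
            ⟨fun ⟨l, hl, hU''⟩ => by obtain ⟨j, rfl⟩ := heCsur l hl; exact ⟨j, hU''⟩, fun ⟨j, hU''⟩ => ⟨eC j, heC j, hU''⟩⟩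
          rw [e1, e2]
        · -- THE DELETION: the `m - k` swaps avoiding `x`, level `t' + 1`; served by the induction hypothesis
          intro r' u' cols' hu' hc' hU' hJ'
          let eA : Fin k' ↪o Fin m := (Finset.univ.filter fun l => x ∉ A l).orderEmbOfFin hk'
          let eC : Fin k' ↪o Fin m := (Finset.univ.filter fun l => x ∉ C l).orderEmbOfFin hk'C
          have heA : ∀ j, x ∉ A (eA j) := fun j =>
            (Finset.mem_filter.1 (Finset.orderEmbOfFin_mem (Finset.univ.filter fun l => x ∉ A l) hk' j)).2
          have heC : ∀ j, x ∉ C (eC j) := fun j =>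
            (Finset.mem_filter.1 (Finset.orderEmbOfFin_mem (Finset.univ.filter fun l => x ∉ C l) hk'C j)).2
          have heAsur : ∀ l, x ∉ A l → ∃ j, eA j = l := fun l hl => by
            have : l ∈ Set.range eA := by
              rw [show Set.range eA = ↑(Finset.univ.filter fun l => x ∉ A l) from Finset.range_orderEmbOfFin _ hk']
              simp [hl]
            exact this
          have heCsur : ∀ l, x ∉ C l → ∃ j, eC j = l := fun l hl => by
            have : l ∈ Set.range eC := by
              rw [show Set.range eC = ↑(Finset.univ.filter fun l => x ∉ C l) from Finset.range_orderEmbOfFin _ hk'C]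
              simp [hl]
            exact this
          refine ih (S.erase x) hS' k' (by omega) (t' + 1) (fun j => A (eA j)) (fun j => C (eC j))
            (fun j => hA _) (fun j => hC _) (fun j j' hjj' => eA.injective (hAi hjj'))
            (fun j j' hjj' => eC.injective (hCi hjj')) (fun j j' => hAC _ _)
            (fun j a ha => Finset.mem_erase.2 ⟨fun hax => heA j (hax ▸ ha), hAS _ ha⟩)
            (fun j a ha => Finset.mem_erase.2 ⟨fun hax => heC j (hax ▸ ha), hCS _ ha⟩)
            u' cols' hu' hc' (fun U => ?_) hJ'
          rw [hU' U]
          have e1 : (∀ l, x ∉ A l → U ≠ A l) ↔ ∀ j, U ≠ A (eA j) :=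
            ⟨fun H' j => H' (eA j) (heA j), fun H' l hl => by obtain ⟨j, rfl⟩ := heAsur l hl; exact H' j⟩
          have e2 : (∃ l, x ∉ C l ∧ U = C l) ↔ ∃ j, U = C (eC j) :=
            ⟨fun ⟨l, hl, hU''⟩ => by obtain ⟨j, rfl⟩ := heCsur l hl; exact ⟨j, hU''⟩, fun ⟨j, hU''⟩ => ⟨eC j, heC j, hU''⟩⟩
          rw [e1, e2]
    · -- no balanced coordinate in `S`: a totally unbalanced core with support `S`
      push Not at hbal
      set σ := (S.orderEmbOfFin rfl).toEmbedding with hσ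
      let A' : Fin m → Finset (Fin S.card) := fun l => (A l).preimage σ σ.injective.injOn
      let C' : Fin m → Finset (Fin S.card) := fun l => (C l).preimage σ σ.injective.injOn
      have hA' : ∀ l, (A' l).map σ = A l := fun l => map_preimage_orderEmb S (A l) (hAS l)
      have hC' : ∀ l, (C' l).map σ = C l := fun l => map_preimage_orderEmb S (C l) (hCS l)
      have hA'c : ∀ l, (A' l).card = t := fun l => by rw [← Finset.card_map σ, hA' l, hA l]
      have hC'c : ∀ l, (C' l).card = t + 1 := fun l => by rw [← Finset.card_map σ, hC' l, hC l]
      have hA'i : Function.Injective A' := fun l l' hll' => hAi (by rw [← hA' l, ← hA' l']; exact congrArg _ hll')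
      have hC'i : Function.Injective C' := fun l l' hll' => hCi (by rw [← hC' l, ← hC' l']; exact congrArg _ hll')
      have hA'C' : ∀ l l', ¬ A' l ⊆ C' l' := fun l l' hsub => hAC l l' (by
        rw [← hA' l, ← hC' l']; exact Finset.map_subset_map.2 hsub)
      have hunb : ∀ y : Fin S.card, (Finset.univ.filter fun l => y ∈ A' l).card ≠
          (Finset.univ.filter fun l => y ∈ C' l).card := by
        intro y
        have hyS : σ y ∈ S := by
          have : σ y ∈ Set.range (S.orderEmbOfFin rfl) := ⟨y, rfl⟩
          rw [Finset.range_orderEmbOfFin] at this; exact this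
        have e1 : (Finset.univ.filter fun l => y ∈ A' l) = Finset.univ.filter fun l => σ y ∈ A l := by
          ext l; simp [A', Finset.mem_preimage]
        have e2 : (Finset.univ.filter fun l => y ∈ C' l) = Finset.univ.filter fun l => σ y ∈ C l := by
          ext l; simp [C', Finset.mem_preimage]
        rw [e1, e2]; exact hbal (σ y) hyS
      refine served_image_of_served S.card t σ A' C' (H m hm S.card t A' C' hA'c hC'c hA'i hC'i hA'C' hunb)
        u cols hu ?_ ?_
      · intro U
        rw [hU U, hσ, map_orderEmb_univ]
        simp only [← hσ, hA', hC']
      · intro J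
        rw [hJ J, hσ, map_orderEmb_univ]

/-- ★★ **THE m-TH SHELL REDUCES TO ITS TOTALLY UNBALANCED CORES.**  If for every `m ≤ M` every totally unbalanced m-swap family is
served on its support, then for every `m ≤ M` every m-swap family is served, for all `h, t`. -/
theorem exists_table_multiSwap_of_unbalanced (M : ℕ)
    (H : ∀ m, m ≤ M → ∀ (n t : ℕ) (A C : Fin m → Finset (Fin n)), (∀ l, (A l).card = t) → (∀ l, (C l).card = t + 1) →
      Function.Injective A → Function.Injective C → (∀ l l', ¬ A l ⊆ C l') →
      (∀ x : Fin n, (Finset.univ.filter fun l => x ∈ A l).card ≠ (Finset.univ.filter fun l => x ∈ C l).card) →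
      ∀ ⦃r : ℕ⦄ (u cols : Fin r → Finset (Fin n)), Function.Injective u →
        (∀ i, ((u i).card ≤ t ∧ ∀ l, u i ≠ A l) ∨ ∃ l, u i = C l) →
        (∀ J : Finset (Fin n), J.card ≤ t → ∃ kk, cols kk = J) →
        ∃ tx : Option (Fin n) → Fin n → ℂ,
          (Matrix.of fun i kk : Fin r => ∏ a ∈ u i, (tx none a + ∑ q ∈ cols kk, tx (some q) a)).det ≠ 0)
    {m : ℕ} (hm : m ≤ M) (h t : ℕ) (A C : Fin m → Finset (Fin h))
    (hA : ∀ l, (A l).card = t) (hC : ∀ l, (C l).card = t + 1)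
    (hAi : Function.Injective A) (hCi : Function.Injective C) (hAC : ∀ l l', ¬ A l ⊆ C l')
    {r : ℕ} (u cols : Fin r → Finset (Fin h)) (hu : Function.Injective u)
    (hU : ∀ i, ((u i).card ≤ t ∧ ∀ l, u i ≠ A l) ∨ ∃ l, u i = C l)
    (hcols : ∀ J : Finset (Fin h), J.card ≤ t → ∃ kk, cols kk = J) :
    ∃ tx : Option (Fin h) → Fin h → ℂ,
      (Matrix.of fun i kk : Fin r => ∏ a ∈ u i, (tx none a + ∑ q ∈ cols kk, tx (some q) a)).det ≠ 0 := by
  classical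
  obtain ⟨hcinj, hUr, hJr⟩ := rigidity t A C hA hC hAi hCi u cols hu hU hcols
  rw [exists_table_iff_symGood]
  exact served_multiSwap_on_of_unbalanced M H _ Finset.univ rfl m hm t A C hA hC hAi hCi hAC
    (fun l => Finset.subset_univ _) (fun l => Finset.subset_univ _) u cols hu hcinj
    (fun U => by rw [hUr U]; simp) (fun J => by rw [hJr J]; simp)

end BallCut

end

end Summit.ValiantsHypothesis.ValiantsHypothesis.Theorems.BarrierLever.HiddenStates
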